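import Mathlib
import Summits.Ventures.PercRepro2.LeafRowPendantRootSO
import Summits.Ventures.PercRepro2.BHKEvents

/-!
# The open sign `crossA′so` holds when `v` is wired to `a₁` by a sure edge
(blind cell PercRepro2, p5 g32; `proofs/P5-OEDGE.md` §42 (8), S4 §2.4 (s) addendum 19)

Let `e` be an edge with ends `a₁, v`.  With `e` pinned open every event `vL = {a₁ ↔ v}` is sure
(`prob_update_one_inter_vL`, `prob_update_one_vL`), so
`crossA′so(p[e ↦ 1]) = 2·Z·P(Q,oH,bH) − P(Q,oH)·P(Q,bH)`, which is nonnegative by the positive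
association of the explored cluster `C(a₂)` given `Q = {a₂ ↮ a₁}` (van den Berg–Häggström–Kahn
1.3, `bhk_same_cluster_events`).  This is the top Bernstein coefficient `B₃` of `crossA′so` along an
`a₁–v` edge — the sign at `G/a₁v` needs no induction — one of the three coefficients of the
a₁-edge induction skeleton (the middle ones are the open part).  Own work; standard axioms.
-/

namespace Summit.Ventures.PercRepro2

open LeafRowPendantRootSO

namespace CrossAPrimeA1V

section Sure

variable {V : Type*} {E : Type*} [Fintype E] [DecidableEq E] {R : Type*} [CommRing R]

omit [Fintype E] [DecidableEq E] in
/-- An open `a₁–v` edge gives `a₁ ↔ v`. -/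
lemma openEdge_subset_vL {ends : E → Sym2 V} {e : E} {a₁ v : V} (he : ends e = s(a₁, v)) :
    openEdge e ⊆ connEvent ends a₁ v :=
  fun _ ho => conn_of_openAdj ⟨e, ho, he⟩

/-- With `e = {a₁, v}` pinned open, `vL` can be dropped from every event. -/
lemma prob_update_one_inter_vL (p : E → R) {ends : E → Sym2 V} {e : E} {a₁ v : V}
    (he : ends e = s(a₁, v)) (A X : Set (Config E)) :
    prob (Function.update p e 1) (A ∩ (connEvent ends a₁ v ∩ X)) =
      prob (Function.update p e 1) (A ∩ X) := by
  rw [← prob_update_one_inter_openEdge, ← prob_update_one_inter_openEdge p (A ∩ X)]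
  congr 1
  ext ω
  simp only [Set.mem_inter_iff]
  constructor
  · rintro ⟨⟨hA, _, hX⟩, ho⟩; exact ⟨⟨hA, hX⟩, ho⟩
  · rintro ⟨⟨hA, hX⟩, ho⟩; exact ⟨⟨hA, openEdge_subset_vL he ho, hX⟩, ho⟩

/-- With `e = {a₁, v}` pinned open, `π_v = 1`. -/
lemma prob_update_one_vL (p : E → R) {ends : E → Sym2 V} {e : E} {a₁ v : V}
    (he : ends e = s(a₁, v)) : prob (Function.update p e 1) (connEvent ends a₁ v) = 1 := by
  calc prob (Function.update p e 1) (connEvent ends a₁ v)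
      = prob (Function.update p e 1) (connEvent ends a₁ v ∩ openEdge e) :=
        (prob_update_one_inter_openEdge p _ e).symm
    _ = prob (Function.update p e 1) (openEdge e) := by
        rw [Set.inter_eq_right.2 (openEdge_subset_vL he)]
    _ = prob (Function.update p e 1) (Set.univ ∩ openEdge e) := by rw [Set.univ_inter]
    _ = prob (Function.update p e 1) Set.univ := prob_update_one_inter_openEdge p Set.univ e
    _ = 1 := prob_univ _

end Sure

section Main

variable {V : Type*} {E : Type*} [Fintype E] [DecidableEq E] [Fintype V] [DecidableEq V]
  {R : Type*} [Field R] [LinearOrder R] [IsStrictOrderedRing R]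

omit [Fintype E] [DecidableEq E] [Fintype V] [DecidableEq V] in
/-- `Q` as the complement of `a₂ ↔ a₁`. -/
lemma avoidAll_singleton_eq (ends : E → Sym2 V) (a₁ a₂ : V) :
    avoidAll ends a₂ {a₁} = (connEvent ends a₂ a₁)ᶜ := by
  ext ω
  simp [mem_avoidAll, connEvent]

omit [Fintype E] [DecidableEq E] [Fintype V] [DecidableEq V] in
/-- `{o ∈ C(a₂)}` as a cluster event. -/
lemma clusterInEvent_mem_eq (ends : E → Sym2 V) (a₂ o : V) :
    clusterInEvent ends a₂ {W | o ∈ W} = connEvent ends a₂ o := by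
  ext ω
  simp [clusterInEvent, connEvent]

/-- **The positive association of `C(a₂)` given `Q` in `Q`-mass form**:
`P(Q,oH)·P(Q,bH) ≤ P(Q,oH,bH)·P(Q)`. -/
lemma prob_Q_oH_mul_prob_Q_bH_le (p : E → R) (hp : IsProbVec p) (ends : E → Sym2 V)
    (o a₁ a₂ b : V) :
    prob p (avoidAll ends a₂ {a₁} ∩ connEvent ends a₂ o) *
        prob p (avoidAll ends a₂ {a₁} ∩ connEvent ends a₂ b) ≤
      prob p (avoidAll ends a₂ {a₁} ∩ (connEvent ends a₂ o ∩ connEvent ends a₂ b)) *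
        prob p (avoidAll ends a₂ {a₁}) := by
  have h := bhk_same_cluster_events p hp ends a₂ a₁ (𝓤 := {W | o ∈ W}) (𝓥 := {W | b ∈ W})
    (fun _ _ hWW' ho => hWW' ho) (fun _ _ hWW' hb => hWW' hb)
  rw [clusterInEvent_mem_eq, clusterInEvent_mem_eq, ← avoidAll_singleton_eq] at h
  rw [Set.inter_comm (avoidAll ends a₂ {a₁}) (connEvent ends a₂ o),
    Set.inter_comm (avoidAll ends a₂ {a₁}) (connEvent ends a₂ b),
    Set.inter_comm (avoidAll ends a₂ {a₁}) (connEvent ends a₂ o ∩ connEvent ends a₂ b)]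
  exact h

/-- **The sign at `G/a₁v`**: with the edge `e = {a₁, v}` pinned open, `0 ≤ crossA′so`. -/
theorem crossA'so_nonneg_update_one {p : E → R} (hp : IsProbVec p) {ends : E → Sym2 V} {e : E}
    {o a₁ a₂ v b : V} (he : ends e = s(a₁, v)) :
    0 ≤ crossA'so (Function.update p e 1) ends o a₁ a₂ v b := by
  have hp₁ : IsProbVec (Function.update p e 1) := hp.update e zero_le_one le_rfl
  unfold crossA'so
  rw [prob_update_one_inter_vL p he, prob_update_one_inter_vL p he, prob_update_one_inter_vL p he,
    prob_update_one_vL p he]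
  have hPA := prob_Q_oH_mul_prob_Q_bH_le _ hp₁ ends o a₁ a₂ b
  have hD := prob_nonneg hp₁ (avoidAll ends a₂ {a₁} ∩ (connEvent ends a₂ o ∩ connEvent ends a₂ b))
  have hZ := prob_nonneg hp₁ (avoidAll ends a₂ {a₁})
  nlinarith [mul_nonneg hD hZ]

end Main

end CrossAPrimeA1V

end Summit.Ventures.PercRepro2
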